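import Literature.MathematicalPhysics.QuantumFieldTheory.Balaban1983to89.B9Thm37Glue
import Literature.MathematicalPhysics.QuantumFieldTheory.Balaban1983to89.B11SectG

/-!
# `Balaban1983to89.B9Thm37AllNorms` — [B9] Theorem 3.7 and Corollary 3.8 (pp. 408–410): the random walk expansion
# (3.90) of G′ summed in an ARBITRARY block norm at the open end of the walk — «The expansion is convergent in all
# norms appearing in the inequalities (3.42)–(3.47)» / «Similar estimates hold for the other norms», kernel-checked

T. Bałaban, *Propagators for lattice gauge theories in a background field*, Commun. Math. Phys. **99**, 389–434 (1985)
[Balaban1985BackgroundPropagators] (cell paper B9; held `paper:balaban1985-cmp99-background-propagators`, journal page =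
PDF page + 388); [4] = T. Bałaban, *Propagators and renormalization transformations for lattice gauge theories. II*,
Commun. Math. Phys. **96**, 223–250 (1984) [Balaban1984PropagatorsII]; [3] = part I, Commun. Math. Phys. **95**, 17–40
(1984) [Balaban1984PropagatorsI].

statement-level skeleton of published theorems with citation tags; proofs where landed; nothing here is a claim about the Yang–Mills mass gap

CITATION HEADER (lean-in-tree rule).  THE PRINTED LOCI (verbatim; p. 409 [PDF 21] – p. 410 [PDF 22], the same spans
certified in the header of `…B9Thm37Sum`): (p. 409) *"Theorem 3.7. For M sufficiently large, and a configuration U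
satisfying (3.35), the operator G′ can be represented as G′ = G′₀(I − R′)^{−1} = G′₀Σ_{n=0}^∞ R′ⁿ
= Σ_ω h_{□₀}G′_{□₀}h_{□₀}K(h_{□₁})G′_{□₁}h_{□₁}…K(h_{□ₙ})G′_{□ₙ}h_{□ₙ}, (3.90) where ω = (□₀, □₁, …, □ₙ), □ᵢ ∈ 𝒟,
□ᵢ ∩ □ᵢ₊₁ ≠ ∅.  The expansion is convergent in all norms appearing in the inequalities (3.42)–(3.47)."*; (p. 410) *"This
theorem follows simply from Corollary 3.6 holding for all G′_□, □ ∈ 𝒟, from the bound (3.89) and Lemma 2.1. The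
arguments are exactly the same as in proofs of Proposition 1.2 [3] and Proposition 2.2 [4], so we will not repeat them
here. Theorem 3.7 implies that all the inequalities (3.42)–(3.47) hold for G′, thus we have completed the proof of
Theorem 3.1."*; (p. 410, Corollary 3.8) *"|Δ(y)h_{□₀}G′_{□₀}h_{□₀}Π_{i=1}^n K(h_{□ᵢ})G′_{□ᵢ}h_{□ᵢ}Δ(y′)λ|
≤ O(1)(L^jη)²O(M^{−1/2})^{|ω|}M^{−½|ω|}e^{−½δ₀d(ω,y,y′)}|Δ(y′)λ| (3.94) for y ∈ □₀ ∩ Λ_j, y′ ∈ □ₙ.  Similar estimates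
hold for the other norms.  We will use the factor O(M^{−1/2}) to control the sum over random walks ω"*.  The norms of
(3.42)–(3.47) (pp. 397–398 [PDF 9–10]): the sup entries (3.42), the Hölder entries (3.43)–(3.45) (norm (3.40)), the
L² entries (3.46), the weighted global entries (3.47) (norm (3.41)).

WHAT THE TREE HAD.  `…B9Thm37Sum` / `…B9Thm37Glue` sum the walk (3.90) in the SUP block-majorant shape of (3.42)
(`B6RandomWalk.HasMajorant`, `B6RandomWalkHom.HasMajorantHom`): `thm37_entry1`, `thm37_leftEntry_of_342` (entries 1, 2,
4), `thm37_rightEntry_of_342` (entry 3), `cor38_walk_majorant`, `walkSum_majorant`.  The sentence *"convergent in ALL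
norms appearing in (3.42)–(3.47)"* and Corollary 3.8's *"Similar estimates hold for the other norms"* — the Hölder
members (3.43)/(3.45), the L² members (3.46), the weighted members (3.47) of the expansion — had no theorem (cell
lit-balaban, r06 `B9-CLOSURE.md` §3 item 1 (ii)/(iv), items (N)/(O) for the Sect. C walk).

WHAT THIS FILE CERTIFIES (0 sorry; theorems only; no `def`, no new named fact).  The walk is summed with BOTH ends of
the open factor measured in ARBITRARY block norms `b₁` (input λ: the space F₁ of lattice functions where G′, Δ′_a, the
T_□ = h_□G′_□h_□ and R_□ = K(h_□)G′_□h_□ act) and `b₂` (output, any ℝ-module F₂ read through a linear E : F₁ → F₂) in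
the vocabulary of `…B11SectG` ([Balaban1985Variational] Sect. G: local sizes `b.loc y`, a partition of unity `b.cut` of
cost `b.κ`, localisation `b.IsLoc`; majorants `B11SectG.HasMaj b₁ b₂ T K` = *"size of Tμ near y ≤ K(y,y′)·size of μ,
μ localised near y′"*).  The inner factors R_□ of (3.90) carry (3.89) in the norm `b₁`; the first factor T_{□₀} carries
the E-member of Corollary 3.6 — exactly how the printed proof treats the *"other norms"*.  Instances: `b₁ = b₂` = sharp
blocks `BlockNorm.ofBlocks` (the sup shape of (3.42); κ = 1) recovers `…B9Thm37Sum`/`…B9Thm37Glue`; `b₂` = a Hölder or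
weighted local size gives (3.43)/(3.47); `b₁ = b₂ = B9SectDL2Decay.l2w` (block-L² sizes) gives (3.46).
* §1 tools: Finset sums and overlap-localised sums of `HasMaj` majorants ((3.87) summed: `hasMaj_finsetSum`,
  `hasMaj_localSum`); powers and walk products in a block norm with the cutting cost κ per inserted partition of unity
  (`hasMaj_pow_chain` = [4] (2.52)/(2.55)ₐ, `hasMaj_lprod` = (3.91)); the composite of an `HasMaj`-operator after a
  sup-majorised one (`hasMaj_comp_sup`); the convolution estimate of [4] (2.66) with an output weight `W(y)`
  (`conv_weight_le`); c₁(α) ≥ 1 (`one_le_c1_of_ineq261`); an a-priori constant majorant for any linear map between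
  finite function lattices in the sup sizes (`exists_hasMaj_const_ofBlocks`); the conservativity
  `hasMaj_of_hasMajorantHom` (the two-space sup calculus of `B6RandomWalkHom` is the case `b₂ = ofBlocks blkZ`) and the
  sharp-block facts `ofBlocks_loc_mulOp_le`, `ofBlocks_isLoc_mulOp`, `blockSupp_of_isLoc`.
* §2 **`neumann_right`** — the RIGHT Neumann series A₀ = S + A₀R′ of (3.90) (`B9Thm37Sum.fixedPoint_of_388`:
  G′ = G′₀ + G′R′) over block norms: S : F₁ → F₂ with majorant A·W(y)e^{−δ₀d(y,y′)} from `b₁` into `b₂`, R′ with majorant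
  θe^{−δ₀d} in `b₁` ((3.89) summed), [4] Lemma 2.1 at the exponent α ((2.61) `Ineq261`, (2.63) `Ineq263`), the located
  smallness κ₁θc₁(α) < 1 and an a-priori constant majorant of A₀ ⇒ A₀ has majorant Ac₁(α)(1 − κ₁θc₁(α))⁻¹W(y)
  e^{−(1−α)δ₀d} (the terms SR′ⁿ by (2.63) and one convolution; the remainder A₀R′ᴺ → 0; `telescope_right`).  The
  companion of `B11SectG.neumann_majorant` (LEFT form A₀ = S + K′A₀, constant weight) for the form print uses in (3.90).
* §3 **`thm37_left`** — THEOREM 3.7 FOR A LEFT MEMBER E FROM `b₁` INTO `b₂` (E = 1, ∇_U, Δ_U into sup sizes: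
  (3.42)₁,₂,₄; E = ∇_U into a Hölder local size: (3.43); E = 1, ∇_U, ∇_U∇_U between block-L² sizes: (3.46)₁,₂,₅;
  weighted sup sizes: (3.47)), from the per-cube LEGS `hleg` (the E-member of Corollary 3.6 for h_□G′_□h_□, localised to
  S_□ — in print: Cor. 3.6 for G′_□ plus the Leibniz/product rule of E through h_□; `leg_of_sandwich` manufactures it
  when E passes h_□ at no cost), the localized (3.89) majorants `h389` of the K(h_□)G′_□h_□ in `b₁`, the overlap counts
  N, N′, G′Δ′_a = I and (3.88) summed, Lemma 2.1 and κ₁N′θc₁(α) < 1: EG′ has majorant NAc₁(α)(1 − κ₁N′θc₁(α))⁻¹W(y)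
  e^{−(1−α)δ₀d(y,y′)}; **`thm37_left_explicit`**: *"for M sufficiently large"* — θ = θ₀M⁻¹ and M ≥ 2κ₁N′θ₀c₁(α) give the
  constant 2NAc₁(α).  For `b₁ = b₂ = ofBlocks blk`, `E = 1` this is `B9Thm37Sum.thm37_entry1` with the same constants
  (`thm37_entry1_of_left`, a consistency check; the a-priori bound is automatic there).
* §4 **`cor38_left`** — COROLLARY 3.8 FROM `b₁` INTO `b₂` (lattice functions F₁ = X → ℝ): the term of a walk ω with
  |ω| = n has majorant 1_{S₀}(y)AW(y)(κ₁θc₁(α))ⁿe^{−(1−α)δ₀dω(y,y′)} for every admissible dω ((3.93), `B9Thm37Sum.LB`;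
  `hasMaj_lprod_left`); **`walkSum_left`** — the Proposition 1.2 [3] route: with ≤ Dⁿ walks of length n from each cube
  and Dq ≤ ½ every partial sum of (3.90), read through E, has majorant 2NAW(y)e^{−δ′d(y,y′)} — *"convergent in all
  norms appearing in the inequalities (3.42)–(3.47)"*.

HONEST SCOPE (hypotheses of the printed shape, each named; none is a cited fact).  (i) Corollary 3.6 for the G′_□ in the
E-member (the legs `hleg`) and (3.89) in the norm `b₁` (`h389`) are INPUTS, as in `…B9Thm37Sum`/`…B9Thm37Glue` (the
latter derives `h389` and the sup legs from (3.42)₁,₂ for G′_□ and the coefficient sizes of K(h_□), and enters here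
through `B11SectG.hasMaj_of_hasMajorant` / `hasMaj_of_hasMajorantHom`; for other norms the leg is the corresponding
member of Cor. 3.6 plus a product rule and (3.89) is the corresponding operator bound — G-B9-02/G-B9-07 of the cell);
(ii) the a-priori constant majorant `hap` of EG′ (finite lattice) is an input for abstract norms; it is discharged for
sup sizes here (`exists_hasMaj_const_ofBlocks`) and for block-L² sizes by `B9SectDL2Decay.exists_hasMaj_l2w_const`;
(iii) RIGHT and two-sided members ((3.42)₃, (3.44)–(3.45), (3.46)₃,₄,₆: an operator on the input side of G′) are the
sequel file (the LEFT Neumann form, `B11SectG.neumann_majorant` / `B6RandomWalkHom.hom_majorant_of_leftFixedPoint`);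
(iv) the multiscale distance d of [4] (2.46) in the exponents (cell DIVERGENCE D-b09.13), the counts N, N′, D as
hypotheses (G-B9-22); no instance of a concrete lattice operator is constructed here.  Value = kernel-checked
bookkeeping of a printed *"we will not repeat them here"*, NOT summit progress; nothing continuum, nothing about the
mass gap.  Seat `pub-ymgap-dag-n06-b` (HUMAN RULING D-0062, node N06), 2026-08-25; rows B9.Thm3.7 × B9.Cor3.8 ×
(3.43)/(3.46)/(3.47) (cells only).
-/

namespace Literature.MathematicalPhysics.QuantumFieldTheory.Balaban1983to89.B9Thm37AllNorms

open Literature.MathematicalPhysics.QuantumFieldTheory.Balaban1983to89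
open Finset B6RandomWalk B6RandomWalkHom B9Thm37Sum B11SectG

noncomputable section

/-! ## §1  Tools: sums, localisation, composition with sup-majorised factors, the weighted convolution -/

section Tools

variable {G : B6.Geometry}
variable {F₁ F₂ : Type} [AddCommGroup F₁] [Module ℝ F₁] [AddCommGroup F₂] [Module ℝ F₂]

/-- Finset-indexed sums of operators: the majorants add up (*"A summation preserves it also"*, [4] p. 232).
[cite: Balaban1984PropagatorsII, p.232 (after (2.52))] -/
theorem hasMaj_finsetSum {b₁ : BlockNorm G F₁} {b₂ : BlockNorm G F₂} {ι : Type} (s : Finset ι)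
    (T : ι → F₁ →ₗ[ℝ] F₂) (K : ι → G.Site → G.Site → ℝ) (h : ∀ i ∈ s, HasMaj b₁ b₂ (T i) (K i)) :
    HasMaj b₁ b₂ (∑ i ∈ s, T i) (fun a c => ∑ i ∈ s, K i a c) := by
  classical
  induction s using Finset.induction_on with
  | empty => simpa using hasMaj_zero b₁ b₂
  | insert i s hi ih =>
      have h' := (h i (Finset.mem_insert_self i s)).add (ih fun j hj => h j (Finset.mem_insert_of_mem hj))
      simpa [Finset.sum_insert hi] using h'

/-- **Sums of LOCALIZED operators** ((3.87) G′₀ = Σ_□h_□G′_□h_□ and R′ = Σ_□K(h_□)G′_□h_□ read through any member E):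
majorants χ_□(y)κ(y,y′) with Σ_□χ_□(y) ≤ N (finite overlap of the cubes □̃) sum to N·κ. [cite: Balaban1985BackgroundPropagators, (3.87)–(3.89) p.409] -/
theorem hasMaj_localSum {b₁ : BlockNorm G F₁} {b₂ : BlockNorm G F₂} {ι : Type} [Fintype ι]
    (T : ι → F₁ →ₗ[ℝ] F₂) (χ : ι → G.Site → ℝ) (κ : G.Site → G.Site → ℝ) (N : ℝ)
    (hκ : ∀ a c, 0 ≤ κ a c) (hT : ∀ i, HasMaj b₁ b₂ (T i) (fun a c => χ i a * κ a c))
    (hN : ∀ a, ∑ i, χ i a ≤ N) :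
    HasMaj b₁ b₂ (∑ i, T i) (fun a c => N * κ a c) := by
  refine (hasMaj_finsetSum Finset.univ T _ fun i _ => hT i).mono fun a c => ?_
  calc (∑ i, χ i a * κ a c) = (∑ i, χ i a) * κ a c := by rw [Finset.sum_mul]
    _ ≤ N * κ a c := mul_le_mul_of_nonneg_right (hN a) (hκ a c)

variable {X : Type} [Fintype X]

/-- The sharp-block sup sizes of [4] (2.51) cut at cost 1. [folklore] -/
private theorem ofBlocks_κ (blk : X → G.Site) : (BlockNorm.ofBlocks G blk).κ = 1 := rfl

/-- Localisation in the sharp-block sizes is *"supp μ ⊂ Δ(y′)"* ([4] p. 232). [cite: Balaban1984PropagatorsII, (2.51) p.232] -/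
theorem ofBlocks_isLoc (blk : X → G.Site) (y' : G.Site) (μ : X → ℝ) :
    (BlockNorm.ofBlocks G blk).IsLoc y' μ ↔ ∀ x, blk x ≠ y' → μ x = 0 := Iff.rfl

/-- The sharp-block size of y′ bounds |μ| on the block of y′. [folklore] -/
private theorem abs_le_ofBlocks_loc (blk : X → G.Site) (y' : G.Site) (μ : X → ℝ) (x : X) (hx : blk x = y') :
    |μ x| ≤ (BlockNorm.ofBlocks G blk).loc y' μ := by
  classical
  show |μ x| ≤ ⨆ x : X, if blk x = y' then |μ x| else 0
  refine le_trans ?_ (le_ciSup (Finite.bddAbove_range _) x)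
  simp [hx]

/-- A localised function with its sharp-block size is a `BlockSupp` datum of [4] (2.51). [cite: Balaban1984PropagatorsII, (2.51) p.232] -/
theorem blockSupp_of_isLoc (blk : X → G.Site) {y' : G.Site} {μ : X → ℝ}
    (hμ : (BlockNorm.ofBlocks G blk).IsLoc y' μ) :
    BlockSupp blk μ y' ((BlockNorm.ofBlocks G blk).loc y' μ) :=
  ⟨(BlockNorm.ofBlocks G blk).loc_nonneg y' μ, fun x hx => abs_le_ofBlocks_loc blk y' μ x hx, fun x hx => hμ x hx⟩

/-- Monotonicity of the sharp-block sup size in the pointwise absolute values on the block. [folklore] -/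
private theorem ofBlocks_loc_mono (blk : X → G.Site) (y : G.Site) {ν μ : X → ℝ}
    (h : ∀ x, blk x = y → |ν x| ≤ |μ x|) :
    (BlockNorm.ofBlocks G blk).loc y ν ≤ (BlockNorm.ofBlocks G blk).loc y μ := by
  classical
  show (⨆ x : X, if blk x = y then |ν x| else 0) ≤ (BlockNorm.ofBlocks G blk).loc y μ
  by_cases hX : Nonempty X
  · refine ciSup_le fun x => ?_
    split_ifs with hx
    · exact (h x hx).trans (abs_le_ofBlocks_loc blk y μ x hx)
    · exact (BlockNorm.ofBlocks G blk).loc_nonneg y μ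
  · rw [not_nonempty_iff] at hX
    simp only [iSup_of_empty', Real.sSup_empty]
    exact (BlockNorm.ofBlocks G blk).loc_nonneg y μ

/-- Multiplication by a function with |h| ≤ 1 does not increase the sharp-block sup sizes (the h_□ of the partition
of unity, p. 408). [cite: Balaban1985BackgroundPropagators, (3.87) p.409] -/
theorem ofBlocks_loc_mulOp_le (blk : X → G.Site) (y : G.Site) (h : X → ℝ) (hh : ∀ x, |h x| ≤ 1) (μ : X → ℝ) :
    (BlockNorm.ofBlocks G blk).loc y (mulOp h μ) ≤ (BlockNorm.ofBlocks G blk).loc y μ :=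
  ofBlocks_loc_mono blk y fun x _ => by
    rw [mulOp_apply, abs_mul]
    calc |h x| * |μ x| ≤ 1 * |μ x| := mul_le_mul_of_nonneg_right (hh x) (abs_nonneg _)
      _ = |μ x| := one_mul _

/-- **An `HasMaj`-operator after a sup-majorised one**: T₁ : (X → ℝ) → F with majorant K₁ ≥ 0 from the sharp-block
sizes into `b`, after T₂ on the lattice with the [4] (2.51)-majorant K₂ ≥ 0, has the 𝔅-convolution Σ_{y″}K₁(y,y″)K₂(y″,y′)
(cutting cost 1) — the composition step of (3.91) with the open end of the walk in the norm `b`.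
[cite: Balaban1985BackgroundPropagators, (3.91) p.410; Balaban1984PropagatorsII, (2.52)–(2.55) p.232] -/
theorem hasMaj_comp_sup (blk : X → G.Site) {b : BlockNorm G F₂} {T₁ : (X → ℝ) →ₗ[ℝ] F₂}
    {T₂ : Module.End ℝ (X → ℝ)} {K₁ K₂ : G.Site → G.Site → ℝ}
    (h₁ : HasMaj (BlockNorm.ofBlocks G blk) b T₁ K₁) (h₂ : HasMajorant blk T₂ K₂)
    (hK₁ : ∀ a c, 0 ≤ K₁ a c) (hK₂ : ∀ a c, 0 ≤ K₂ a c) :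
    HasMaj (BlockNorm.ofBlocks G blk) b (T₁ ∘ₗ T₂) (fun a c => ∑ y'' : G.Site, K₁ a y'' * K₂ y'' c) := by
  have h := hasMaj_comp h₁ (hasMaj_of_hasMajorant blk hK₂ h₂) hK₁
  refine h.mono fun a c => le_of_eq (Finset.sum_congr rfl fun y'' _ => ?_)
  rw [ofBlocks_κ, one_mul]

omit [Fintype X] in
/-- **The convolution of [4] (2.66) with an output weight**: Σ_{y″}A·W(y)e^{−δ₀d(y,y″)}·r·e^{−(1−α)δ₀d(y″,y′)} ≤
A·c₁(α)·W(y)·r·e^{−(1−α)δ₀d(y,y′)} — split e^{−δ₀d} = e^{−(1−α)δ₀d}e^{−αδ₀d}, the triangle inequality (2.54) and the row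
sum (2.61) (the computation inside `B6RandomWalk.majorant_G0_mul_265`, with the weight W(y) in place of P(y)).
[cite: Balaban1984PropagatorsII, (2.54) p.233, (2.61) and (2.66) p.234] -/
theorem conv_weight_le (d : ℕ) (δ₀ α A r : ℝ) (W : G.Site → ℝ) (hA : 0 ≤ A) (hW : ∀ y, 0 ≤ W y) (hr : 0 ≤ r)
    (hαδ : 0 ≤ (1 - α) * δ₀) (htri : Triangle254 G) (h261 : Ineq261 d G δ₀ α) (a c : G.Site) :
    ∑ y'' : G.Site, A * W a * Real.exp (-(δ₀ * G.dist a y'')) * (r * Real.exp (-((1 - α) * δ₀ * G.dist y'' c))) ≤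
      A * B6.c1 d δ₀ α * W a * r * Real.exp (-((1 - α) * δ₀ * G.dist a c)) := by
  have hterm : ∀ y'' : G.Site,
      A * W a * Real.exp (-(δ₀ * G.dist a y'')) * (r * Real.exp (-((1 - α) * δ₀ * G.dist y'' c))) ≤
        A * W a * r * Real.exp (-((1 - α) * δ₀ * G.dist a c)) * Real.exp (-(α * δ₀ * G.dist a y'')) := by
    intro y''
    have hexp : Real.exp (-(δ₀ * G.dist a y'')) * Real.exp (-((1 - α) * δ₀ * G.dist y'' c)) ≤
        Real.exp (-((1 - α) * δ₀ * G.dist a c)) * Real.exp (-(α * δ₀ * G.dist a y'')) := by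
      rw [← Real.exp_add, ← Real.exp_add]
      refine Real.exp_le_exp.mpr ?_
      have := mul_le_mul_of_nonneg_left (htri a y'' c) hαδ
      nlinarith
    have := mul_le_mul_of_nonneg_left hexp (mul_nonneg (mul_nonneg hA (hW a)) hr)
    calc A * W a * Real.exp (-(δ₀ * G.dist a y'')) * (r * Real.exp (-((1 - α) * δ₀ * G.dist y'' c)))
        = A * W a * r * (Real.exp (-(δ₀ * G.dist a y'')) * Real.exp (-((1 - α) * δ₀ * G.dist y'' c))) := by ring
      _ ≤ A * W a * r * (Real.exp (-((1 - α) * δ₀ * G.dist a c)) * Real.exp (-(α * δ₀ * G.dist a y''))) := this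
      _ = _ := by ring
  calc ∑ y'' : G.Site, A * W a * Real.exp (-(δ₀ * G.dist a y'')) * (r * Real.exp (-((1 - α) * δ₀ * G.dist y'' c)))
      ≤ ∑ y'' : G.Site, A * W a * r * Real.exp (-((1 - α) * δ₀ * G.dist a c)) *
          Real.exp (-(α * δ₀ * G.dist a y'')) := Finset.sum_le_sum fun y'' _ => hterm y''
    _ = A * W a * r * Real.exp (-((1 - α) * δ₀ * G.dist a c)) *
          ∑ y'' : G.Site, Real.exp (-(α * δ₀ * G.dist a y'')) := by rw [Finset.mul_sum]
    _ ≤ A * W a * r * Real.exp (-((1 - α) * δ₀ * G.dist a c)) * B6.c1 d δ₀ α :=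
        mul_le_mul_of_nonneg_left (h261 a)
          (mul_nonneg (mul_nonneg (mul_nonneg hA (hW a)) hr) (Real.exp_nonneg _))
    _ = A * B6.c1 d δ₀ α * W a * r * Real.exp (-((1 - α) * δ₀ * G.dist a c)) := by ring

variable {Z : Type} [Fintype Z]

/-- **A-priori bound on a finite lattice** (only to let N → ∞ in (3.90), as in [4] (2.66)): every linear map from the
functions on a finite lattice X to those on Z has a CONSTANT majorant between the sharp-block sup sizes (expand the
input in point masses) — the finite-lattice bound behind the passage to the limit in [4] (2.66) (*"The random walk
representation (2.50) is convergent in the norms defined by these inequalities"*), cf. `B6RandomWalk.exists_opBound`.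
[cite: Balaban1984PropagatorsII, (2.66) p.234] -/
theorem exists_hasMaj_const_ofBlocks (blk : X → G.Site) (blkZ : Z → G.Site) (T : (X → ℝ) →ₗ[ℝ] (Z → ℝ)) :
    ∃ M₀ : ℝ, 0 ≤ M₀ ∧ HasMaj (BlockNorm.ofBlocks G blk) (BlockNorm.ofBlocks G blkZ) T (fun _ _ => M₀) := by
  classical
  refine ⟨∑ x' : X, ∑ z : Z, |T (Pi.single x' 1) z|,
    Finset.sum_nonneg fun _ _ => Finset.sum_nonneg fun _ _ => abs_nonneg _, ?_⟩
  intro y' μ hμ y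
  set B : ℝ := (BlockNorm.ofBlocks G blk).loc y' μ with hB
  have hB0 : 0 ≤ B := (BlockNorm.ofBlocks G blk).loc_nonneg y' μ
  have hμB : ∀ x : X, |μ x| ≤ B := by
    intro x
    by_cases hx : blk x = y'
    · exact abs_le_ofBlocks_loc blk y' μ x hx
    · rw [hμ x hx, abs_zero]; exact hB0
  have hdec : μ = ∑ x' : X, μ x' • (Pi.single x' (1 : ℝ) : X → ℝ) := by
    funext z
    rw [Finset.sum_apply]
    simp [Pi.single_apply]
  have hpt : ∀ z : Z, |T μ z| ≤ (∑ x' : X, ∑ z : Z, |T (Pi.single x' 1) z|) * B := by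
    intro z
    have hTμ : T μ z = ∑ x' : X, μ x' * T (Pi.single x' 1) z := by
      conv_lhs => rw [hdec, map_sum, Finset.sum_apply]
      refine Finset.sum_congr rfl fun x' _ => ?_
      rw [map_smul, Pi.smul_apply, smul_eq_mul]
    rw [hTμ]
    calc |∑ x' : X, μ x' * T (Pi.single x' 1) z|
        ≤ ∑ x' : X, |μ x' * T (Pi.single x' 1) z| := Finset.abs_sum_le_sum_abs _ _
      _ = ∑ x' : X, |μ x'| * |T (Pi.single x' 1) z| := Finset.sum_congr rfl fun x' _ => abs_mul _ _
      _ ≤ ∑ x' : X, B * |T (Pi.single x' 1) z| :=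
          Finset.sum_le_sum fun x' _ => mul_le_mul_of_nonneg_right (hμB x') (abs_nonneg _)
      _ = (∑ x' : X, |T (Pi.single x' 1) z|) * B := by
          rw [Finset.sum_mul]; exact Finset.sum_congr rfl fun _ _ => mul_comm _ _
      _ ≤ (∑ x' : X, ∑ z : Z, |T (Pi.single x' 1) z|) * B :=
          mul_le_mul_of_nonneg_right (Finset.sum_le_sum fun x' _ =>
            Finset.single_le_sum (fun w _ => abs_nonneg (T (Pi.single x' 1) w)) (Finset.mem_univ z)) hB0
  show (⨆ z : Z, if blkZ z = y then |T μ z| else 0) ≤ (∑ x' : X, ∑ z : Z, |T (Pi.single x' 1) z|) * B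
  have hC0 : 0 ≤ (∑ x' : X, ∑ z : Z, |T (Pi.single x' 1) z|) * B :=
    mul_nonneg (Finset.sum_nonneg fun _ _ => Finset.sum_nonneg fun _ _ => abs_nonneg _) hB0
  by_cases hZ : Nonempty Z
  · refine ciSup_le fun z => ?_
    split_ifs
    · exact hpt z
    · exact hC0
  · rw [not_nonempty_iff] at hZ
    simp only [iSup_of_empty', Real.sSup_empty]
    exact hC0

/-- **Conservativity**: a two-space sup majorant `B6RandomWalkHom.HasMajorantHom blk blkZ T K` of the lineage
`…B9Thm37Glue` with K ≥ 0 IS a `HasMaj` between the sharp-block sup sizes — so every statement below with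
`b = BlockNorm.ofBlocks G blkZ` specialises to that lineage's shape (the printed shape (2.51) of [4] read between two
lattices). [cite: Balaban1984PropagatorsII, (2.51) p.232] -/
theorem hasMaj_of_hasMajorantHom (blk : X → G.Site) (blkZ : Z → G.Site) {T : (X → ℝ) →ₗ[ℝ] (Z → ℝ)}
    {K : G.Site → G.Site → ℝ} (hK : ∀ a c, 0 ≤ K a c) (h : HasMajorantHom blk blkZ T K) :
    HasMaj (BlockNorm.ofBlocks G blk) (BlockNorm.ofBlocks G blkZ) T K := by
  classical
  intro y' μ hμ y
  set B : ℝ := (BlockNorm.ofBlocks G blk).loc y' μ with hB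
  have hB0 : 0 ≤ B := (BlockNorm.ofBlocks G blk).loc_nonneg y' μ
  have hpt : ∀ z : Z, |T μ z| ≤ K (blkZ z) y' * B := h y' μ B (blockSupp_of_isLoc blk hμ)
  show (⨆ z : Z, if blkZ z = y then |T μ z| else 0) ≤ K y y' * B
  by_cases hZ : Nonempty Z
  · refine ciSup_le fun z => ?_
    split_ifs with hz
    · simpa [hz] using hpt z
    · exact mul_nonneg (hK _ _) hB0
  · rw [not_nonempty_iff] at hZ
    simp only [iSup_of_empty', Real.sSup_empty]
    exact mul_nonneg (hK _ _) hB0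

/-- **Powers in a block norm** ([4] (2.52)/(2.55)ₐ for R₁ = … = R_n, with the cutting cost κ of the norm): Tⁿ
(n = m + 1 ≥ 1 factors, T with majorant K ≥ 0 in `b`) has majorant κᵐ·Σ_{y₁…y_m}K(y,y₁)⋯K(y_m,y′) = κᵐ·`chain K m`.
[cite: Balaban1984PropagatorsII, (2.52)–(2.55) p.232] -/
theorem hasMaj_pow_chain (b : BlockNorm G F₁) {T : Module.End ℝ F₁} {K : G.Site → G.Site → ℝ}
    (h : HasMaj b b T K) (hK : ∀ a c, 0 ≤ K a c) (m : ℕ) :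
    HasMaj b b (T ^ (m + 1)) (fun a c => b.κ ^ m * chain K m a c) := by
  induction m with
  | zero =>
      refine (h.congr fun μ => ?_).mono fun a c => le_of_eq ?_
      · rw [zero_add, pow_one]
      · rw [pow_zero, one_mul, chain_zero]
  | succ m ih =>
      have hc := hasMaj_comp h ih hK
      refine (hc.congr fun μ => ?_).mono fun a c => le_of_eq ?_
      · rw [LinearMap.comp_apply, pow_succ' T (m + 1), Module.End.mul_apply]
      · rw [chain_succ, Finset.mul_sum]
        exact Finset.sum_congr rfl fun z _ => by ring

omit [Fintype X] in
/-- **Products along a walk in a block norm** ((3.91): *"inserting characteristic functions of Δ(y), y ∈ 𝔅, between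
the operators K(h_□)G′_□h_□"* — here the partition of unity `b.cut` of the norm, at cost κ per insertion): if every
factor Fᵢ (i ≤ n) has majorant Kᵢ ≥ 0 in `b`, the product F₀F₁⋯Fₙ has majorant κⁿ·Σ_{y₁…yₙ}K₀(y,y₁)⋯Kₙ(yₙ,y′) =
κⁿ·`lchain K n`. [cite: Balaban1985BackgroundPropagators, (3.91) p.410; Balaban1984PropagatorsII, (2.52) p.232] -/
theorem hasMaj_lprod (b : BlockNorm G (X → ℝ)) (Fs : ℕ → Module.End ℝ (X → ℝ)) (K : ℕ → G.Site → G.Site → ℝ) :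
    ∀ n : ℕ, (∀ i ≤ n, HasMaj b b (Fs i) (K i)) → (∀ i ≤ n, ∀ a c, 0 ≤ K i a c) →
      HasMaj b b (lprod Fs n) (fun a c => b.κ ^ n * lchain K n a c) := by
  intro n
  induction n generalizing Fs K with
  | zero =>
      intro h _
      exact (h 0 le_rfl).mono fun a c => le_of_eq (by rw [pow_zero, one_mul]; rfl)
  | succ m ih =>
      intro h hK
      have htail := ih (fun i => Fs (i + 1)) (fun i => K (i + 1)) (fun i hi => h (i + 1) (by omega))
        (fun i hi => hK (i + 1) (by omega))
      have hc := hasMaj_comp (h 0 (Nat.zero_le _)) htail (hK 0 (Nat.zero_le _))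
      refine (hc.congr fun μ => ?_).mono fun a c => le_of_eq ?_
      · simp only [LinearMap.comp_apply, lprod, Module.End.mul_apply]
      · show ∑ y'', K 0 a y'' * (b.κ * (b.κ ^ m * lchain (fun i => K (i + 1)) m y'' c)) =
          b.κ ^ (m + 1) * lchain K (m + 1) a c
        simp only [lchain, Finset.mul_sum]
        exact Finset.sum_congr rfl fun z _ => by ring

/-- The row-sum constant of [4] Lemma 2.1 is at least 1 as soon as 𝔅 has a point (the diagonal term of (2.61),
d(y,y) = 0). [cite: Balaban1984PropagatorsII, (2.61) p.234] -/
theorem one_le_c1_of_ineq261 (d : ℕ) (δ₀ α : ℝ) (hrefl : ∀ y : G.Site, G.dist y y = 0)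
    (h261 : Ineq261 d G δ₀ α) (y : G.Site) : 1 ≤ B6.c1 d δ₀ α := by
  have h := h261 y
  have hdiag : Real.exp (-(α * δ₀ * G.dist y y)) = 1 := by rw [hrefl y, mul_zero, neg_zero, Real.exp_zero]
  calc (1 : ℝ) = Real.exp (-(α * δ₀ * G.dist y y)) := hdiag.symm
    _ ≤ ∑ y' : G.Site, Real.exp (-(α * δ₀ * G.dist y y')) :=
        Finset.single_le_sum (f := fun y' => Real.exp (-(α * δ₀ * G.dist y y'))) (fun y' _ => (Real.exp_pos _).le)
          (Finset.mem_univ y)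
    _ ≤ B6.c1 d δ₀ α := h

end Tools

/-! ## §2  The RIGHT Neumann series of (3.90) over block norms: A₀ = S + A₀R′ -/

section NeumannRight

variable {G : B6.Geometry}
variable {F₁ F₂ : Type} [AddCommGroup F₁] [Module ℝ F₁] [AddCommGroup F₂] [Module ℝ F₂]

/-- (3.90) read as a telescoping identity (the algebra of [4] (2.50)/(2.66)): if A₀ν = Sν + A₀(R′ν) for all ν then
A₀μ = Σ_{n<N} S(R′ⁿμ) + A₀(R′ᴺμ) for every N. [cite: Balaban1985BackgroundPropagators, (3.90) p.409] -/
theorem telescope_right {A0 S : F₁ →ₗ[ℝ] F₂} {R : Module.End ℝ F₁}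
    (hfix : ∀ ν, A0 ν = S ν + A0 (R ν)) (N : ℕ) (μ : F₁) :
    A0 μ = (∑ n ∈ Finset.range N, S ((R ^ n) μ)) + A0 ((R ^ N) μ) := by
  induction N with
  | zero => simp
  | succ N ih =>
      have hstep : S ((R ^ N) μ) + A0 ((R ^ (N + 1)) μ) = A0 ((R ^ N) μ) := by
        rw [hfix ((R ^ N) μ), pow_succ', Module.End.mul_apply]
      rw [Finset.sum_range_succ, add_assoc, hstep]
      exact ih

/-- **The right Neumann series over block norms** (the mechanism of Theorem 3.7 / [4] (2.64)–(2.66) / [3] Prop. 1.2,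
with arbitrary norms at BOTH ends of the open factor).  Let A₀, S : F₁ → F₂ and R′ : F₁ → F₁ satisfy A₀ = S + A₀R′
(pointwise), S with majorant A·W(y)e^{−δ₀d(y,y′)} from the block norm `b₁` into `b₂` (W ≥ 0 an output weight:
(L^jη)², L^jη, (L^jη)^{1−β}(‖ζ‖_β + |ζ|), …), R′ with majorant θe^{−δ₀d} in `b₁` ((3.89) summed; θ = O(M⁻¹)), Lemma 2.1
of [4] at the exponent α ((2.61), (2.63)), the located smallness κ₁θc₁(α) < 1 (κ₁ = the cutting cost of `b₁`, = 1 for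
sharp blocks; *"M sufficiently large"*) and an a-priori constant majorant M₀ of A₀ (finite lattice).  Then A₀ has
majorant A·c₁(α)·(1 − κ₁θc₁(α))⁻¹·W(y)·e^{−(1−α)δ₀d(y,y′)}: the n-th term SR′ⁿ has majorant Ac₁(α)W(y)(κ₁θc₁(α))ⁿ
e^{−(1−α)δ₀d} by (2.63) (`hasMaj_pow_chain` + `Ineq263`) and one convolution (`conv_weight_le`); the remainder A₀R′ᴺ
has a constant majorant O((κ₁θc₁(α))ᴺ) → 0.  Companion of `B11SectG.neumann_majorant` (the LEFT form A₀ = S + K′A₀).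
[cite: Balaban1985BackgroundPropagators, Thm 3.7 (3.90) pp.409–410; Balaban1984PropagatorsII, (2.64)–(2.66) p.234] -/
theorem neumann_right (b₁ : BlockNorm G F₁) (b₂ : BlockNorm G F₂) (d : ℕ) (δ₀ α θ A M₀ : ℝ) (W : G.Site → ℝ)
    {A0 S : F₁ →ₗ[ℝ] F₂} {R : Module.End ℝ F₁}
    (hA : 0 ≤ A) (hW : ∀ y, 0 ≤ W y) (hθ : 0 ≤ θ) (hM₀ : 0 ≤ M₀) (hαδ : 0 ≤ α * δ₀) (h1αδ : 0 ≤ (1 - α) * δ₀)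
    (htri : Triangle254 G) (hrefl : ∀ y : G.Site, G.dist y y = 0) (hdnn : ∀ y y' : G.Site, 0 ≤ G.dist y y')
    (h261 : Ineq261 d G δ₀ α) (h263 : Ineq263 d G δ₀ α) (hsmall : b₁.κ * θ * B6.c1 d δ₀ α < 1)
    (hS : HasMaj b₁ b₂ S (fun a c => A * W a * Real.exp (-(δ₀ * G.dist a c))))
    (hR : HasMaj b₁ b₁ R (fun a c => θ * Real.exp (-(δ₀ * G.dist a c))))
    (hfix : ∀ ν, A0 ν = S ν + A0 (R ν))
    (hap : HasMaj b₁ b₂ A0 (fun _ _ => M₀)) :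
    HasMaj b₁ b₂ A0
      (fun a c => A * B6.c1 d δ₀ α * (1 - b₁.κ * θ * B6.c1 d δ₀ α)⁻¹ * W a *
        Real.exp (-((1 - α) * δ₀ * G.dist a c))) := by
  set cα : ℝ := B6.c1 d δ₀ α with hcα
  set q : ℝ := b₁.κ * θ * cα with hqdef
  have hc0 : 0 ≤ cα := c1_nonneg d δ₀ α
  have hq0 : 0 ≤ q := mul_nonneg (mul_nonneg b₁.κ_nonneg hθ) hc0
  -- if 𝔅 is empty there is nothing to prove; otherwise c₁(α) ≥ 1
  by_cases hne : Nonempty G.Site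
  swap
  · intro y' μ _ y
    exact (hne ⟨y⟩).elim
  have hc1 : 1 ≤ cα := one_le_c1_of_ineq261 d δ₀ α hrefl h261 (Classical.arbitrary _)
  -- (2.63): R′ⁿ⁺¹ has majorant κ₁ⁿ(θc₁)ⁿ⁺¹e^{−(1−α)δ₀d}
  have hRn : ∀ m : ℕ, HasMaj b₁ b₁ (R ^ (m + 1))
      (fun a c => b₁.κ ^ m * (θ * cα) ^ (m + 1) * Real.exp (-((1 - α) * δ₀ * G.dist a c))) := by
    intro m
    refine (hasMaj_pow_chain b₁ hR (fun a c => mul_nonneg hθ (Real.exp_nonneg _)) m).mono fun a c => ?_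
    rw [chain_const_mul, mul_pow]
    have h263' := h263 m a c
    have hnn : 0 ≤ b₁.κ ^ m * θ ^ (m + 1) := mul_nonneg (pow_nonneg b₁.κ_nonneg m) (pow_nonneg hθ _)
    calc b₁.κ ^ m * (θ ^ (m + 1) * chain (fun a c => Real.exp (-(δ₀ * G.dist a c))) m a c)
        = b₁.κ ^ m * θ ^ (m + 1) * chain (fun a c => Real.exp (-(δ₀ * G.dist a c))) m a c := by ring
      _ ≤ b₁.κ ^ m * θ ^ (m + 1) * (cα ^ (m + 1) * Real.exp (-((1 - α) * δ₀ * G.dist a c))) :=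
          mul_le_mul_of_nonneg_left h263' hnn
      _ = _ := by ring
  -- the n-th term S R′ⁿ has majorant A c₁ W(y) qⁿ e^{−(1−α)δ₀d}
  have hterm : ∀ n : ℕ, HasMaj b₁ b₂ (S ∘ₗ (R ^ n))
      (fun a c => A * cα * W a * q ^ n * Real.exp (-((1 - α) * δ₀ * G.dist a c))) := by
    intro n
    cases n with
    | zero =>
        refine (hS.congr fun μ => ?_).mono fun a c => ?_
        · rw [LinearMap.comp_apply, pow_zero, Module.End.one_apply]
        · have hexp : Real.exp (-(δ₀ * G.dist a c)) ≤ Real.exp (-((1 - α) * δ₀ * G.dist a c)) := by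
            refine Real.exp_le_exp.mpr ?_
            have := mul_nonneg hαδ (hdnn a c)
            nlinarith
          have hAW : 0 ≤ A * W a := mul_nonneg hA (hW a)
          calc A * W a * Real.exp (-(δ₀ * G.dist a c)) ≤ A * W a * Real.exp (-((1 - α) * δ₀ * G.dist a c)) :=
                mul_le_mul_of_nonneg_left hexp hAW
            _ = A * 1 * W a * q ^ 0 * Real.exp (-((1 - α) * δ₀ * G.dist a c)) := by ring
            _ ≤ A * cα * W a * q ^ 0 * Real.exp (-((1 - α) * δ₀ * G.dist a c)) := by
                have : A * 1 ≤ A * cα := mul_le_mul_of_nonneg_left hc1 hA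
                have h2 : 0 ≤ W a * q ^ 0 * Real.exp (-((1 - α) * δ₀ * G.dist a c)) :=
                  mul_nonneg (mul_nonneg (hW a) (pow_nonneg hq0 0)) (Real.exp_nonneg _)
                calc A * 1 * W a * q ^ 0 * Real.exp (-((1 - α) * δ₀ * G.dist a c))
                    = A * 1 * (W a * q ^ 0 * Real.exp (-((1 - α) * δ₀ * G.dist a c))) := by ring
                  _ ≤ A * cα * (W a * q ^ 0 * Real.exp (-((1 - α) * δ₀ * G.dist a c))) :=
                      mul_le_mul_of_nonneg_right this h2
                  _ = _ := by ring
    | succ m =>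
        have h := hasMaj_comp hS (hRn m) (fun a c => mul_nonneg (mul_nonneg hA (hW a)) (Real.exp_nonneg _))
        refine h.mono fun a c => ?_
        have hr : 0 ≤ b₁.κ * (b₁.κ ^ m * (θ * cα) ^ (m + 1)) :=
          mul_nonneg b₁.κ_nonneg (mul_nonneg (pow_nonneg b₁.κ_nonneg m) (pow_nonneg (mul_nonneg hθ hc0) _))
        have hconv := conv_weight_le d δ₀ α A (b₁.κ * (b₁.κ ^ m * (θ * cα) ^ (m + 1))) W hA hW hr h1αδ htri
          h261 a c
        have hq' : b₁.κ * (b₁.κ ^ m * (θ * cα) ^ (m + 1)) = q ^ (m + 1) := by rw [hqdef]; ring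
        calc ∑ y'', A * W a * Real.exp (-(δ₀ * G.dist a y'')) *
              (b₁.κ * (b₁.κ ^ m * (θ * cα) ^ (m + 1) * Real.exp (-((1 - α) * δ₀ * G.dist y'' c))))
            = ∑ y'', A * W a * Real.exp (-(δ₀ * G.dist a y'')) *
              (b₁.κ * (b₁.κ ^ m * (θ * cα) ^ (m + 1)) * Real.exp (-((1 - α) * δ₀ * G.dist y'' c))) :=
              Finset.sum_congr rfl fun y'' _ => by ring
          _ ≤ A * cα * W a * (b₁.κ * (b₁.κ ^ m * (θ * cα) ^ (m + 1))) *
              Real.exp (-((1 - α) * δ₀ * G.dist a c)) := hconv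
          _ = A * cα * W a * q ^ (m + 1) * Real.exp (-((1 - α) * δ₀ * G.dist a c)) := by rw [hq']
  -- the partial sums
  have hpartial : ∀ N : ℕ, HasMaj b₁ b₂ (∑ n ∈ Finset.range N, S ∘ₗ (R ^ n))
      (fun a c => ∑ n ∈ Finset.range N, A * cα * W a * q ^ n * Real.exp (-((1 - α) * δ₀ * G.dist a c))) :=
    fun N => hasMaj_sum (fun n => S ∘ₗ (R ^ n)) _ hterm N
  -- the remainder A₀ R′ᴺ: constant majorant (|𝔅| + 1)·M₀·qᴺ
  set Cst : ℝ := ((Fintype.card G.Site : ℝ) + 1) * M₀ with hCst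
  have hCst0 : 0 ≤ Cst := mul_nonneg (by positivity) hM₀
  have hrem : ∀ N : ℕ, HasMaj b₁ b₂ (A0 ∘ₗ (R ^ N)) (fun _ _ => Cst * q ^ N) := by
    intro N
    cases N with
    | zero =>
        refine (hap.congr fun μ => ?_).mono fun a c => ?_
        · rw [LinearMap.comp_apply, pow_zero, Module.End.one_apply]
        · rw [pow_zero, mul_one, hCst]
          have : (0 : ℝ) ≤ (Fintype.card G.Site : ℝ) := Nat.cast_nonneg _
          nlinarith
    | succ m =>
        have h := hasMaj_comp hap (hRn m) (fun _ _ => hM₀)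
        refine h.mono fun a c => ?_
        have hle : ∀ y'' : G.Site, M₀ * (b₁.κ * (b₁.κ ^ m * (θ * cα) ^ (m + 1) *
            Real.exp (-((1 - α) * δ₀ * G.dist y'' c)))) ≤ M₀ * q ^ (m + 1) := by
          intro y''
          have hexp : Real.exp (-((1 - α) * δ₀ * G.dist y'' c)) ≤ 1 := by
            rw [Real.exp_le_one_iff]
            have := mul_nonneg h1αδ (hdnn y'' c)
            linarith
          have hq' : b₁.κ * (b₁.κ ^ m * (θ * cα) ^ (m + 1)) = q ^ (m + 1) := by rw [hqdef]; ring
          have hr : 0 ≤ b₁.κ * (b₁.κ ^ m * (θ * cα) ^ (m + 1)) :=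
            mul_nonneg b₁.κ_nonneg (mul_nonneg (pow_nonneg b₁.κ_nonneg m) (pow_nonneg (mul_nonneg hθ hc0) _))
          calc M₀ * (b₁.κ * (b₁.κ ^ m * (θ * cα) ^ (m + 1) * Real.exp (-((1 - α) * δ₀ * G.dist y'' c))))
              = M₀ * (b₁.κ * (b₁.κ ^ m * (θ * cα) ^ (m + 1))) * Real.exp (-((1 - α) * δ₀ * G.dist y'' c)) := by
                ring
            _ ≤ M₀ * (b₁.κ * (b₁.κ ^ m * (θ * cα) ^ (m + 1))) * 1 :=
                mul_le_mul_of_nonneg_left hexp (mul_nonneg hM₀ hr)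
            _ = M₀ * q ^ (m + 1) := by rw [mul_one, hq']
        calc ∑ y'' : G.Site, M₀ * (b₁.κ * (b₁.κ ^ m * (θ * cα) ^ (m + 1) *
              Real.exp (-((1 - α) * δ₀ * G.dist y'' c))))
            ≤ ∑ _y'' : G.Site, M₀ * q ^ (m + 1) := Finset.sum_le_sum fun y'' _ => hle y''
          _ = (Fintype.card G.Site : ℝ) * (M₀ * q ^ (m + 1)) := by
              rw [Finset.sum_const, nsmul_eq_mul, Finset.card_univ]
          _ ≤ ((Fintype.card G.Site : ℝ) + 1) * (M₀ * q ^ (m + 1)) :=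
              mul_le_mul_of_nonneg_right (by linarith) (mul_nonneg hM₀ (pow_nonneg hq0 _))
          _ = Cst * q ^ (m + 1) := by rw [hCst]; ring
  -- pointwise in (y′, μ, y), for every N, then N → ∞
  intro y' μ hμ y
  set ℓ : ℝ := b₁.loc y' μ with hℓ
  have hℓ0 : 0 ≤ ℓ := b₁.loc_nonneg y' μ
  set C : ℝ := A * cα * (1 - q)⁻¹ * W y * Real.exp (-((1 - α) * δ₀ * G.dist y y')) * ℓ with hC
  have hgeomC : ∀ N : ℕ,
      (∑ n ∈ Finset.range N, A * cα * W y * q ^ n * Real.exp (-((1 - α) * δ₀ * G.dist y y'))) * ℓ ≤ C := by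
    intro N
    have hgeom : ∑ n ∈ Finset.range N, q ^ n ≤ (1 - q)⁻¹ :=
      sum_le_hasSum (Finset.range N) (fun n _ => pow_nonneg hq0 n) (hasSum_geometric_of_lt_one hq0 hsmall)
    have hnn : 0 ≤ A * cα * W y * Real.exp (-((1 - α) * δ₀ * G.dist y y')) * ℓ :=
      mul_nonneg (mul_nonneg (mul_nonneg (mul_nonneg hA hc0) (hW y)) (Real.exp_nonneg _)) hℓ0
    calc (∑ n ∈ Finset.range N, A * cα * W y * q ^ n * Real.exp (-((1 - α) * δ₀ * G.dist y y'))) * ℓ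
        = (∑ n ∈ Finset.range N, q ^ n) * (A * cα * W y * Real.exp (-((1 - α) * δ₀ * G.dist y y')) * ℓ) := by
          rw [Finset.sum_mul, Finset.sum_mul]; exact Finset.sum_congr rfl fun n _ => by ring
      _ ≤ (1 - q)⁻¹ * (A * cα * W y * Real.exp (-((1 - α) * δ₀ * G.dist y y')) * ℓ) :=
          mul_le_mul_of_nonneg_right hgeom hnn
      _ = C := by rw [hC]; ring
  have hN : ∀ N : ℕ, b₂.loc y (A0 μ) ≤ C + Cst * ℓ * q ^ N := by
    intro N
    rw [telescope_right hfix N μ]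
    refine (b₂.loc_add_le y _ _).trans (add_le_add ?_ ?_)
    · have h1 := hpartial N y' μ hμ y
      rw [LinearMap.sum_apply] at h1
      simp only [LinearMap.comp_apply] at h1
      exact h1.trans (hgeomC N)
    · have h2 := hrem N y' μ hμ y
      rw [LinearMap.comp_apply] at h2
      calc b₂.loc y (A0 ((R ^ N) μ)) ≤ Cst * q ^ N * ℓ := h2
        _ = Cst * ℓ * q ^ N := by ring
  have hlim : Filter.Tendsto (fun N : ℕ => C + Cst * ℓ * q ^ N) Filter.atTop (nhds (C + Cst * ℓ * 0)) :=
    ((tendsto_pow_atTop_nhds_zero_of_lt_one hq0 hsmall).const_mul (Cst * ℓ)).const_add C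
  rw [mul_zero, add_zero] at hlim
  have := ge_of_tendsto' hlim hN
  simpa [hC, hqdef, hcα, mul_assoc] using this

end NeumannRight

/-! ## §3  Theorem 3.7 for a LEFT member, arbitrary block norms at both ends -/

section Thm37Left

variable {G : B6.Geometry} [DecidableEq G.Site]
variable {F₁ F₂ : Type} [AddCommGroup F₁] [Module ℝ F₁] [AddCommGroup F₂] [Module ℝ F₂]

/-- **THEOREM 3.7 ⇒ a LEFT member of (3.42)–(3.47) for G′, in the block norms `b₁` (input λ) and `b₂` (output)**
(p. 409: *"The expansion is convergent in all norms appearing in the inequalities (3.42)–(3.47)"*; p. 410: *"This theorem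
follows simply from Corollary 3.6 holding for all G′_□, □∈𝒟, from the bound (3.89) and Lemma 2.1 … Similar estimates
hold for the other norms"*).  Data: the space F₁ of lattice functions where G′, Δ′_a, the terms T_□ = h_□G′_□h_□ of
(3.87) and R_□ = K(h_□)G′_□h_□ of (3.88) act, with a block norm `b₁` (sharp-block sup sizes `BlockNorm.ofBlocks`:
(3.42)–(3.45), (3.47); block-L² sizes `B9SectDL2Decay.l2w`: (3.46)); a linear E : F₁ → F₂ into a block-normed space `b₂`
(E = 1, ∇_U, Δ_U with sup sizes: (3.42)₁,₂,₄; E = ∇_U with a Hölder local size: (3.43); E = 1, ∇_U, ∇_U∇_U with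
block-L² sizes: (3.46)₁,₂,₅; weighted sup sizes: (3.47)).  Hypotheses (printed shape, named): `hleg` — the E-member of
Corollary 3.6 for G′_□ carried by the leg ET_□, localized to S_□ (majorant 1_{S_□}(y)AW(y)e^{−δ₀d}), overlap ≤ N
(`hcnt`); `h389` — (3.89) in the norm `b₁`, localized to S′_□, overlap ≤ N′ (`hcnt'`); `hinv` G′Δ′_a = I and `h388`
Δ′_aΣ_□T_□ = I − Σ_□R_□ ((3.88) summed, `B9Thm37Sum.eq388_sum`); Lemma 2.1 of [4] at α; the located smallness
κ₁N′θc₁(α) < 1 (*"for M sufficiently large"*; κ₁ = 1 for sharp blocks); `hap` an a-priori constant majorant of EG′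
(finite lattice; `exists_hasMaj_const_ofBlocks`, `B9SectDL2Decay.exists_hasMaj_l2w_const`).  Conclusion: EG′ has
majorant NAc₁(α)(1 − κ₁N′θc₁(α))⁻¹W(y)e^{−(1−α)δ₀d(y,y′)} from `b₁` into `b₂` — the E-member for G′ with that
constant and the rate (1 − α)δ₀.
[cite: Balaban1985BackgroundPropagators, Thm 3.7 (3.87)–(3.90) pp.409–410; Balaban1984PropagatorsII, Prop. 2.2 (2.64)–(2.67) p.234] -/
theorem thm37_left (b₁ : BlockNorm G F₁) (b₂ : BlockNorm G F₂) (E : F₁ →ₗ[ℝ] F₂) (d : ℕ)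
    (δ₀ α θ A N N' M₀ : ℝ) (W : G.Site → ℝ) {ι : Type} [Fintype ι] (S S' : ι → Finset G.Site)
    (Tl Rl : ι → Module.End ℝ F₁) {G' Δ : Module.End ℝ F₁}
    (hA : 0 ≤ A) (hW : ∀ y, 0 ≤ W y) (hθ : 0 ≤ θ) (hN : 0 ≤ N) (hN' : 0 ≤ N') (hM₀ : 0 ≤ M₀)
    (hαδ : 0 ≤ α * δ₀) (h1αδ : 0 ≤ (1 - α) * δ₀) (htri : Triangle254 G) (hrefl : ∀ y : G.Site, G.dist y y = 0)
    (hdnn : ∀ y y' : G.Site, 0 ≤ G.dist y y') (h261 : Ineq261 d G δ₀ α) (h263 : Ineq263 d G δ₀ α)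
    (hsmall : b₁.κ * (N' * θ) * B6.c1 d δ₀ α < 1)
    (hleg : ∀ i, HasMaj b₁ b₂ (E ∘ₗ Tl i)
      (fun a c => if a ∈ S i then A * W a * Real.exp (-(δ₀ * G.dist a c)) else 0))
    (hcnt : ∀ a : G.Site, (∑ i, if a ∈ S i then (1 : ℝ) else 0) ≤ N)
    (h389 : ∀ i, HasMaj b₁ b₁ (Rl i)
      (fun a c => if a ∈ S' i then θ * Real.exp (-(δ₀ * G.dist a c)) else 0))
    (hcnt' : ∀ a : G.Site, (∑ i, if a ∈ S' i then (1 : ℝ) else 0) ≤ N')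
    (hinv : G' * Δ = 1) (h388 : Δ * (∑ i, Tl i) = 1 - ∑ i, Rl i)
    (hap : HasMaj b₁ b₂ (E ∘ₗ G') (fun _ _ => M₀)) :
    HasMaj b₁ b₂ (E ∘ₗ G')
      (fun a c => N * A * B6.c1 d δ₀ α * (1 - b₁.κ * (N' * θ) * B6.c1 d δ₀ α)⁻¹ * W a *
        Real.exp (-((1 - α) * δ₀ * G.dist a c))) := by
  -- EG′₀ = Σ_□ ET_□ has majorant N·A·W(y)e^{−δ₀d} ((3.87) read through E)
  have hleg' : ∀ i, HasMaj b₁ b₂ (E ∘ₗ Tl i)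
      (fun a c => (if a ∈ S i then (1 : ℝ) else 0) * (A * W a * Real.exp (-(δ₀ * G.dist a c)))) :=
    fun i => (hleg i).mono fun a c => le_of_eq (by split_ifs <;> simp)
  have hS₀ : HasMaj b₁ b₂ (∑ i, E ∘ₗ Tl i) (fun a c => N * (A * W a * Real.exp (-(δ₀ * G.dist a c)))) :=
    hasMaj_localSum (fun i => E ∘ₗ Tl i) (fun i a => if a ∈ S i then (1 : ℝ) else 0) _ N
      (fun a c => mul_nonneg (mul_nonneg hA (hW a)) (Real.exp_nonneg _)) hleg' hcnt
  have hS : HasMaj b₁ b₂ (E ∘ₗ ∑ i, Tl i) (fun a c => N * A * W a * Real.exp (-(δ₀ * G.dist a c))) := by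
    refine (hS₀.congr fun μ => ?_).mono fun a c => le_of_eq (by ring)
    rw [LinearMap.sum_apply, LinearMap.comp_apply, LinearMap.sum_apply, map_sum]
    rfl
  -- R′ = Σ_□ R_□ has majorant N′θe^{−δ₀d} ((3.89) summed)
  have h389' : ∀ i, HasMaj b₁ b₁ (Rl i)
      (fun a c => (if a ∈ S' i then (1 : ℝ) else 0) * (θ * Real.exp (-(δ₀ * G.dist a c)))) :=
    fun i => (h389 i).mono fun a c => le_of_eq (by split_ifs <;> simp)
  have hR : HasMaj b₁ b₁ (∑ i, Rl i) (fun a c => N' * θ * Real.exp (-(δ₀ * G.dist a c))) := by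
    have h := hasMaj_localSum Rl (fun i a => if a ∈ S' i then (1 : ℝ) else 0)
      (fun a c => θ * Real.exp (-(δ₀ * G.dist a c))) N' (fun a c => mul_nonneg hθ (Real.exp_nonneg _)) h389' hcnt'
    exact h.mono fun a c => le_of_eq (by ring)
  -- (3.90): G′ = G′₀ + G′R′, read through E
  have hfix : G' = (∑ i, Tl i) + G' * ∑ i, Rl i := fixedPoint_of_388 hinv h388
  have hfixE : ∀ ν, (E ∘ₗ G') ν = (E ∘ₗ ∑ i, Tl i) ν + (E ∘ₗ G') ((∑ i, Rl i) ν) := by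
    intro ν
    have h := congrArg (fun T : Module.End ℝ F₁ => E (T ν)) hfix
    simpa only [LinearMap.comp_apply, LinearMap.add_apply, Module.End.mul_apply, map_add] using h
  have hmain := neumann_right b₁ b₂ d δ₀ α (N' * θ) (N * A) M₀ W (mul_nonneg hN hA) hW (mul_nonneg hN' hθ) hM₀ hαδ
    h1αδ htri hrefl hdnn h261 h263 hsmall hS hR hfixE hap
  refine hmain.mono fun a c => le_of_eq ?_
  ring

/-- **"For M sufficiently large", made a number** (Theorem 3.1's *"There exist positive constants M₁, δ₀, B₀"* on the
E-member): with O(M⁻¹) = θ₀M⁻¹ in (3.89) and the explicit threshold M ≥ 2κ₁N′θ₀c₁(α), κ₁N′θ₀M⁻¹c₁(α) ≤ ½ and EG′ has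
majorant 2NAc₁(α)W(y)e^{−(1−α)δ₀d(y,y′)} — the E-member of (3.42)–(3.47) for G′ with constant 2NAc₁(α) and rate
(1 − α)δ₀ (A, δ₀ the constants of Corollary 3.6 in that member; N, N′ the overlap counts; c₁(α) of [4] (2.61); κ₁ the
cutting cost of the input norm, = 1 for sharp blocks). [cite: Balaban1985BackgroundPropagators, Thm 3.1 p.397 + Thm 3.7 pp.409–410] -/
theorem thm37_left_explicit (b₁ : BlockNorm G F₁) (b₂ : BlockNorm G F₂) (E : F₁ →ₗ[ℝ] F₂) (d : ℕ)
    (δ₀ α θ₀ A N N' M₀ : ℝ) (W : G.Site → ℝ) {ι : Type} [Fintype ι] (S S' : ι → Finset G.Site)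
    (Tl Rl : ι → Module.End ℝ F₁) {G' Δ : Module.End ℝ F₁}
    (hA : 0 ≤ A) (hW : ∀ y, 0 ≤ W y) (hθ₀ : 0 < θ₀) (hN : 0 ≤ N) (hN' : 0 ≤ N') (hM₀ : 0 ≤ M₀)
    (hαδ : 0 ≤ α * δ₀) (h1αδ : 0 ≤ (1 - α) * δ₀) (hc₁ : 0 < B6.c1 d δ₀ α) (hM : 0 < G.M)
    (hM₂ : 2 * b₁.κ * N' * θ₀ * B6.c1 d δ₀ α ≤ G.M)
    (htri : Triangle254 G) (hrefl : ∀ y : G.Site, G.dist y y = 0)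
    (hdnn : ∀ y y' : G.Site, 0 ≤ G.dist y y') (h261 : Ineq261 d G δ₀ α) (h263 : Ineq263 d G δ₀ α)
    (hleg : ∀ i, HasMaj b₁ b₂ (E ∘ₗ Tl i)
      (fun a c => if a ∈ S i then A * W a * Real.exp (-(δ₀ * G.dist a c)) else 0))
    (hcnt : ∀ a : G.Site, (∑ i, if a ∈ S i then (1 : ℝ) else 0) ≤ N)
    (h389 : ∀ i, HasMaj b₁ b₁ (Rl i)
      (fun a c => if a ∈ S' i then θ₀ * G.M⁻¹ * Real.exp (-(δ₀ * G.dist a c)) else 0))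
    (hcnt' : ∀ a : G.Site, (∑ i, if a ∈ S' i then (1 : ℝ) else 0) ≤ N')
    (hinv : G' * Δ = 1) (h388 : Δ * (∑ i, Tl i) = 1 - ∑ i, Rl i)
    (hap : HasMaj b₁ b₂ (E ∘ₗ G') (fun _ _ => M₀)) :
    HasMaj b₁ b₂ (E ∘ₗ G')
      (fun a c => 2 * N * A * B6.c1 d δ₀ α * W a * Real.exp (-((1 - α) * δ₀ * G.dist a c))) := by
  set cα : ℝ := B6.c1 d δ₀ α with hcdef
  have hθ : 0 ≤ θ₀ * G.M⁻¹ := mul_nonneg hθ₀.le (inv_nonneg.mpr hM.le)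
  have hq : b₁.κ * (N' * (θ₀ * G.M⁻¹)) * cα ≤ 1 / 2 := by
    have h1 : b₁.κ * (N' * (θ₀ * G.M⁻¹)) * cα = (b₁.κ * N' * θ₀ * cα) / G.M := by
      rw [div_eq_mul_inv]; ring
    rw [h1, div_le_iff₀ hM]
    linarith
  have hsmall : b₁.κ * (N' * (θ₀ * G.M⁻¹)) * cα < 1 := by linarith
  have hinv' : (1 - b₁.κ * (N' * (θ₀ * G.M⁻¹)) * cα)⁻¹ ≤ 2 := by
    rw [inv_le_comm₀ (by linarith) (by norm_num : (0 : ℝ) < 2)]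
    linarith
  have h := thm37_left b₁ b₂ E d δ₀ α (θ₀ * G.M⁻¹) A N N' M₀ W S S' Tl Rl hA hW hθ hN hN' hM₀ hαδ h1αδ htri hrefl
    hdnn h261 h263 hsmall hleg hcnt h389 hcnt' hinv h388 hap
  refine h.mono fun a c => ?_
  have hE : 0 ≤ W a * Real.exp (-((1 - α) * δ₀ * G.dist a c)) := mul_nonneg (hW a) (Real.exp_nonneg _)
  have hNAc : 0 ≤ N * A * cα := mul_nonneg (mul_nonneg hN hA) hc₁.le
  have key : N * A * cα * (1 - b₁.κ * (N' * (θ₀ * G.M⁻¹)) * cα)⁻¹ ≤ 2 * N * A * cα := by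
    calc N * A * cα * (1 - b₁.κ * (N' * (θ₀ * G.M⁻¹)) * cα)⁻¹ ≤ N * A * cα * 2 :=
          mul_le_mul_of_nonneg_left hinv' hNAc
      _ = 2 * N * A * cα := by ring
  calc N * A * cα * (1 - b₁.κ * (N' * (θ₀ * G.M⁻¹)) * cα)⁻¹ * W a * Real.exp (-((1 - α) * δ₀ * G.dist a c))
      = N * A * cα * (1 - b₁.κ * (N' * (θ₀ * G.M⁻¹)) * cα)⁻¹ *
          (W a * Real.exp (-((1 - α) * δ₀ * G.dist a c))) := by ring
    _ ≤ 2 * N * A * cα * (W a * Real.exp (-((1 - α) * δ₀ * G.dist a c))) := mul_le_mul_of_nonneg_right key hE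
    _ = _ := by ring

/-- **The legs from Corollary 3.6 when the reading map passes multiplication by h_□ at no cost** (the sandwich
h_□G′_□h_□ of (3.87) read through a fixed linear Φ : F₁ → F₂, e.g. the identity into sup sizes or the embedding into
block-L² sizes): if ΦG′_□ has majorant K ≥ 0 from `b₁` into `b₂`, multiplication M_h by h_□ preserves localisation and
does not increase the sizes of `b₁` (`hin`, `hin'`; for sharp blocks: `ofBlocks_loc_mulOp_le`), and after Φ it kills
the `b₂`-sizes off S_□ without increasing them (`hout`: supp h_□ within the blocks of S_□, |h_□| ≤ 1), then the leg
Φ(h_□G′_□h_□) has majorant 1_{S_□}(y)K(y,y′).  (Sup case: `B9Thm37Sum.hasMajorant_sandwich_local`.)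
[cite: Balaban1985BackgroundPropagators, (3.87) p.409] -/
theorem leg_of_sandwich (b₁ : BlockNorm G F₁) (b₂ : BlockNorm G F₂) (Φ : F₁ →ₗ[ℝ] F₂)
    {Gop Mh : Module.End ℝ F₁} {K : G.Site → G.Site → ℝ} (hK : ∀ a c, 0 ≤ K a c)
    (hG : HasMaj b₁ b₂ (Φ ∘ₗ Gop) K) (S : Finset G.Site)
    (hin : ∀ (y' : G.Site) (μ : F₁), b₁.IsLoc y' μ → b₁.IsLoc y' (Mh μ))
    (hin' : ∀ (y' : G.Site) (μ : F₁), b₁.loc y' (Mh μ) ≤ b₁.loc y' μ)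
    (hout : ∀ (y : G.Site) (ν : F₁), b₂.loc y (Φ (Mh ν)) ≤ (if y ∈ S then (1 : ℝ) else 0) * b₂.loc y (Φ ν)) :
    HasMaj b₁ b₂ (Φ ∘ₗ (Mh * Gop * Mh)) (fun a c => if a ∈ S then K a c else 0) := by
  intro y' μ hμ y
  have hb := hG y' (Mh μ) (hin y' μ hμ) y
  rw [LinearMap.comp_apply] at hb
  have e : (Φ ∘ₗ (Mh * Gop * Mh)) μ = Φ (Mh (Gop (Mh μ))) := by
    simp only [LinearMap.comp_apply, Module.End.mul_apply]
  rw [e]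
  calc b₂.loc y (Φ (Mh (Gop (Mh μ))))
      ≤ (if y ∈ S then (1 : ℝ) else 0) * b₂.loc y (Φ (Gop (Mh μ))) := hout y _
    _ ≤ (if y ∈ S then (1 : ℝ) else 0) * (K y y' * b₁.loc y' μ) := by
        refine mul_le_mul_of_nonneg_left ?_ (by split_ifs <;> norm_num)
        exact hb.trans (mul_le_mul_of_nonneg_left (hin' y' μ) (hK _ _))
    _ = (if y ∈ S then K y y' else 0) * b₁.loc y' μ := by
        split_ifs <;> ring

variable {X : Type} [Fintype X]

omit [DecidableEq G.Site] in
/-- Multiplication by a lattice function preserves *"supp μ ⊂ Δ(y′)"* (the input `hin` of `leg_of_sandwich` for sharp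
blocks). [cite: Balaban1984PropagatorsII, (2.51) p.232] -/
theorem ofBlocks_isLoc_mulOp (blk : X → G.Site) (h : X → ℝ) (y' : G.Site) (μ : X → ℝ)
    (hμ : (BlockNorm.ofBlocks G blk).IsLoc y' μ) : (BlockNorm.ofBlocks G blk).IsLoc y' (mulOp h μ) := by
  intro x hx
  rw [mulOp_apply, hμ x hx, mul_zero]

/-- **Consistency with the sup lineage**: for `b₁ = b₂` = the sharp-block sup sizes and E = 1, `thm37_left` gives back
the (3.42)₁ majorant of `B9Thm37Sum.thm37_entry1` (same constants; κ₁ = 1), the a-priori bound being automatic on a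
finite lattice (`exists_hasMaj_const_ofBlocks`) and the sup hypotheses entering through `B11SectG.hasMaj_of_hasMajorant`.
[cite: Balaban1985BackgroundPropagators, Thm 3.7 pp.409–410, (3.42) p.397] -/
theorem thm37_entry1_of_left (blk : X → G.Site) (d : ℕ) (δ₀ α θ A N N' : ℝ) (W : G.Site → ℝ)
    {ι : Type} [Fintype ι] (S S' : ι → Finset G.Site) (Tl Rl : ι → Module.End ℝ (X → ℝ))
    {G' Δ : Module.End ℝ (X → ℝ)}
    (hA : 0 ≤ A) (hW : ∀ y, 0 ≤ W y) (hθ : 0 ≤ θ) (hN : 0 ≤ N) (hN' : 0 ≤ N')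
    (hαδ : 0 ≤ α * δ₀) (h1αδ : 0 ≤ (1 - α) * δ₀) (htri : Triangle254 G) (hrefl : ∀ y : G.Site, G.dist y y = 0)
    (hdnn : ∀ y y' : G.Site, 0 ≤ G.dist y y') (h261 : Ineq261 d G δ₀ α) (h263 : Ineq263 d G δ₀ α)
    (hsmall : N' * θ * B6.c1 d δ₀ α < 1)
    (hT : ∀ i, HasMajorant blk (Tl i)
      (fun a c => if a ∈ S i then A * W a * Real.exp (-(δ₀ * G.dist a c)) else 0))
    (hcnt : ∀ a : G.Site, (∑ i, if a ∈ S i then (1 : ℝ) else 0) ≤ N)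
    (h389 : ∀ i, HasMajorant blk (Rl i)
      (fun a c => if a ∈ S' i then θ * Real.exp (-(δ₀ * G.dist a c)) else 0))
    (hcnt' : ∀ a : G.Site, (∑ i, if a ∈ S' i then (1 : ℝ) else 0) ≤ N')
    (hinv : G' * Δ = 1) (h388 : Δ * (∑ i, Tl i) = 1 - ∑ i, Rl i) :
    HasMaj (BlockNorm.ofBlocks G blk) (BlockNorm.ofBlocks G blk) ((1 : Module.End ℝ (X → ℝ)) ∘ₗ G')
      (fun a c => N * A * B6.c1 d δ₀ α * (1 - N' * θ * B6.c1 d δ₀ α)⁻¹ * W a *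
        Real.exp (-((1 - α) * δ₀ * G.dist a c))) := by
  obtain ⟨M₀, hM₀, hap⟩ := exists_hasMaj_const_ofBlocks blk blk ((1 : Module.End ℝ (X → ℝ)) ∘ₗ G')
  have hleg : ∀ i, HasMaj (BlockNorm.ofBlocks G blk) (BlockNorm.ofBlocks G blk)
      ((1 : Module.End ℝ (X → ℝ)) ∘ₗ Tl i)
      (fun a c => if a ∈ S i then A * W a * Real.exp (-(δ₀ * G.dist a c)) else 0) := by
    intro i
    refine (hasMaj_of_hasMajorant blk (fun a c => ?_) (hT i)).congr fun μ => rfl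
    split_ifs
    · exact mul_nonneg (mul_nonneg hA (hW a)) (Real.exp_nonneg _)
    · exact le_rfl
  have h389' : ∀ i, HasMaj (BlockNorm.ofBlocks G blk) (BlockNorm.ofBlocks G blk) (Rl i)
      (fun a c => if a ∈ S' i then θ * Real.exp (-(δ₀ * G.dist a c)) else 0) := by
    intro i
    refine hasMaj_of_hasMajorant blk (fun a c => ?_) (h389 i)
    split_ifs
    · exact mul_nonneg hθ (Real.exp_nonneg _)
    · exact le_rfl
  have hsmall' : (BlockNorm.ofBlocks G blk).κ * (N' * θ) * B6.c1 d δ₀ α < 1 := by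
    rw [ofBlocks_κ, one_mul]; simpa [mul_assoc] using hsmall
  have h := thm37_left (BlockNorm.ofBlocks G blk) (BlockNorm.ofBlocks G blk) (1 : Module.End ℝ (X → ℝ)) d δ₀ α θ A
    N N' M₀ W S S' Tl Rl hA hW hθ hN hN' hM₀ hαδ h1αδ htri hrefl hdnn h261 h263 hsmall' hleg hcnt h389' hcnt' hinv
    h388 hap
  refine h.mono fun a c => le_of_eq ?_
  rw [ofBlocks_κ, one_mul, mul_assoc N' θ]

end Thm37Left

/-! ## §4  Corollary 3.8 and the sum over walks, arbitrary block norms at both ends -/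

section Cor38Left

variable {G : B6.Geometry} [DecidableEq G.Site]
variable {X : Type} {F₂ : Type} [AddCommGroup F₂] [Module ℝ F₂]

omit [DecidableEq G.Site] in
/-- **(3.91) read through E**: the product F₀F₁⋯Fₙ of a walk's factors, the FIRST factor measured through E from `b₁`
into `b₂` (majorant K₀) and the others in `b₁` (Kᵢ ≥ 0), has majorant κ₁ⁿ·Σ_{y₁…yₙ}K₀(y,y₁)K₁(y₁,y₂)⋯Kₙ(yₙ,y′) =
κ₁ⁿ·`lchain K n` from `b₁` into `b₂`. [cite: Balaban1985BackgroundPropagators, (3.91) p.410] -/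
theorem hasMaj_lprod_left (b₁ : BlockNorm G (X → ℝ)) (b₂ : BlockNorm G F₂) (E : (X → ℝ) →ₗ[ℝ] F₂)
    (Fs : ℕ → Module.End ℝ (X → ℝ)) (K : ℕ → G.Site → G.Site → ℝ) (n : ℕ)
    (h0 : HasMaj b₁ b₂ (E ∘ₗ Fs 0) (K 0))
    (hF : ∀ i, 1 ≤ i → i ≤ n → HasMaj b₁ b₁ (Fs i) (K i)) (hK : ∀ i ≤ n, ∀ a c, 0 ≤ K i a c) :
    HasMaj b₁ b₂ (E ∘ₗ lprod Fs n) (fun a c => b₁.κ ^ n * lchain K n a c) := by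
  cases n with
  | zero => exact h0.mono fun a c => le_of_eq (by rw [pow_zero, one_mul]; rfl)
  | succ m =>
      have htail : HasMaj b₁ b₁ (lprod (fun i => Fs (i + 1)) m)
          (fun a c => b₁.κ ^ m * lchain (fun i => K (i + 1)) m a c) :=
        hasMaj_lprod b₁ (fun i => Fs (i + 1)) (fun i => K (i + 1)) m
          (fun i hi => hF (i + 1) (by omega) (by omega)) (fun i hi => hK (i + 1) (by omega))
      have hc := hasMaj_comp h0 htail (hK 0 (Nat.zero_le _))
      refine (hc.congr fun μ => ?_).mono fun a c => le_of_eq ?_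
      · simp only [LinearMap.comp_apply, lprod, Module.End.mul_apply]
      · show ∑ y'', K 0 a y'' * (b₁.κ * (b₁.κ ^ m * lchain (fun i => K (i + 1)) m y'' c)) =
          b₁.κ ^ (m + 1) * lchain K (m + 1) a c
        simp only [lchain, Finset.mul_sum]
        exact Finset.sum_congr rfl fun z _ => by ring

/-- **COROLLARY 3.8, the estimate (3.91)–(3.92) ⇒ (3.94), block norms at both ends** (p. 410: *"Similar estimates hold
for the other norms"*).  A walk ω = (□₀, …, □ₙ) enters through its factors F 0 = h_{□₀}G′_{□₀}h_{□₀} (leg E·F 0 with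
majorant 1_{S₀}(y)AW(y)e^{−δ₀d} from `b₁` into `b₂`: Cor. 3.6's E-member, localized — `hleg0`) and F i =
K(h_{□ᵢ})G′_{□ᵢ}h_{□ᵢ} (majorants 1_{Sᵢ}(y)θe^{−δ₀d} in `b₁`: (3.89), localized — `hR`), Lemma 2.1 of [4] at α ((2.61))
and an admissible lower bound dω(y,y′) of the path lengths (3.93) (`hdω`; d(y,y′) is one by `B9Thm37Sum.LB_dist`).
Then E(F 0·F 1⋯F n) has majorant 1_{S₀}(y)AW(y)(κ₁θc₁(α))ⁿe^{−(1−α)δ₀dω(y,y′)} from `b₁` into `b₂` — (3.94) in the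
E-member, O(1)(L^jη)² ↦ AW(y), O(M^{−1/2})^{|ω|}M^{−½|ω|} ↦ (κ₁θc₁(α))ⁿ (κ₁ = 1 for sharp blocks).
[cite: Balaban1985BackgroundPropagators, Cor. 3.8 (3.91)–(3.94) p.410] -/
theorem cor38_left (b₁ : BlockNorm G (X → ℝ)) (b₂ : BlockNorm G F₂) (E : (X → ℝ) →ₗ[ℝ] F₂) (d : ℕ) (δ₀ α θ A : ℝ)
    (W : G.Site → ℝ) (S : ℕ → Finset G.Site) (Fs : ℕ → Module.End ℝ (X → ℝ)) (dω : G.Site → G.Site → ℝ) (n : ℕ)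
    (hA : 0 ≤ A) (hW : ∀ y, 0 ≤ W y) (hθ : 0 ≤ θ) (hdnn : ∀ y y' : G.Site, 0 ≤ G.dist y y')
    (hαδ : 0 ≤ α * δ₀) (h1αδ : 0 ≤ (1 - α) * δ₀) (h261 : Ineq261 d G δ₀ α)
    (hleg0 : HasMaj b₁ b₂ (E ∘ₗ Fs 0)
      (fun a c => if a ∈ S 0 then A * W a * Real.exp (-(δ₀ * G.dist a c)) else 0))
    (hR : ∀ i, 1 ≤ i → i ≤ n → HasMaj b₁ b₁ (Fs i)
      (fun a c => if a ∈ S i then θ * Real.exp (-(δ₀ * G.dist a c)) else 0))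
    (hdω : ∀ a c : G.Site, LB G.dist S n a c (dω a c)) :
    HasMaj b₁ b₂ (E ∘ₗ lprod Fs n)
      (fun a c => (if a ∈ S 0 then A * W a else 0) * (b₁.κ * θ * B6.c1 d δ₀ α) ^ n *
        Real.exp (-((1 - α) * δ₀ * dω a c))) := by
  -- the weights: w 0 = 1_{S₀}AW, w i = 1_{Sᵢ}θ (i ≥ 1)
  let w : ℕ → G.Site → ℝ := fun i a => if a ∈ S i then (if i = 0 then A * W a else θ) else 0
  have hw0 : ∀ i a, 0 ≤ w i a := fun i a => by
    simp only [w]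
    split_ifs
    · exact mul_nonneg hA (hW a)
    · exact hθ
    · exact le_rfl
  have hwΘ : ∀ i a, 1 ≤ i → w i a ≤ θ := fun i a hi => by
    have hi' : i ≠ 0 := by omega
    simp only [w, hi', if_false]
    split_ifs
    · exact le_rfl
    · exact hθ
  have hwS : ∀ i a, 1 ≤ i → a ∉ S i → w i a = 0 := fun i a _ ha => by
    simp only [w, ha, if_false]
  have h0 : HasMaj b₁ b₂ (E ∘ₗ Fs 0) (fun a c => w 0 a * Real.exp (-(δ₀ * G.dist a c))) := by
    refine hleg0.mono fun a c => le_of_eq ?_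
    simp only [w, if_true]
    split_ifs <;> ring
  have hK : ∀ i, 1 ≤ i → i ≤ n → HasMaj b₁ b₁ (Fs i) (fun a c => w i a * Real.exp (-(δ₀ * G.dist a c))) := by
    intro i hi hin
    have hi' : i ≠ 0 := by omega
    refine (hR i hi hin).mono fun a c => le_of_eq ?_
    simp only [w, hi', if_false]
    split_ifs <;> ring
  have hKnn : ∀ i ≤ n, ∀ (a c : G.Site), 0 ≤ w i a * Real.exp (-(δ₀ * G.dist a c)) := fun i _ a c =>
    mul_nonneg (hw0 i a) (Real.exp_nonneg _)
  have hprod := hasMaj_lprod_left b₁ b₂ E Fs (fun i a c => w i a * Real.exp (-(δ₀ * G.dist a c))) n h0 hK hKnn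
  refine hprod.mono fun a c => ?_
  have hch := lchain_weight_le (St := G.Site) G.dist δ₀ α (B6.c1 d δ₀ α) θ hdnn hαδ h1αδ hθ h261 n S w
    (fun i _ a => hw0 i a) (fun i hi _ a => hwΘ i a hi) (fun i hi _ a ha => hwS i a hi ha) a c (dω a c) (hdω a c)
  have hκ : 0 ≤ b₁.κ ^ n := pow_nonneg b₁.κ_nonneg n
  calc b₁.κ ^ n * lchain (fun i a c => w i a * Real.exp (-(δ₀ * G.dist a c))) n a c
      ≤ b₁.κ ^ n * (w 0 a * (θ * B6.c1 d δ₀ α) ^ n * Real.exp (-((1 - α) * δ₀ * dω a c))) :=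
        mul_le_mul_of_nonneg_left hch hκ
    _ = (if a ∈ S 0 then A * W a else 0) * (b₁.κ * θ * B6.c1 d δ₀ α) ^ n *
          Real.exp (-((1 - α) * δ₀ * dω a c)) := by
        simp only [w, if_true]
        rw [mul_pow, mul_pow, mul_pow]
        ring

/-- **THE SUM OVER WALKS, Proposition 1.2 [3] route, block norms at both ends** (p. 410: *"We will use the factor
O(M^{−1/2}) to control the sum over random walks ω"*).  Cubes indexed by a finite type, `nbrs □` = the cubes meeting □
(at most D, `hD`); EW ω = the term of (3.90) for the walk ω read through E, with the (3.94)-type majorant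
1_{S_{□₀}}(y)AW(y)qⁿe^{−δ′d(y,y′)} from `b₁` into `b₂` for ω ∈ `walksFrom nbrs n □₀` (`hW`; q = κ₁θc₁(α), δ′ = (1 − α)δ₀
from `cor38_left` + `B9Thm37Sum.LB_dist`); overlap ≤ N.  If Dq ≤ ½ (*"M sufficiently large"*) then EVERY partial sum
of (3.90), read through E, has majorant 2NAW(y)e^{−δ′d(y,y′)}, uniformly in the number of terms — the convergence *"in
all norms appearing in (3.42)–(3.47)"* with the constant explicit (`B9.walkSum_le`).
[cite: Balaban1985BackgroundPropagators, Thm 3.7/Cor. 3.8 pp.409–410; Balaban1984PropagatorsI, Prop. 1.2 p.35] -/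
theorem walkSum_left (b₁ : BlockNorm G (X → ℝ)) (b₂ : BlockNorm G F₂) {ι : Type} [Fintype ι] [DecidableEq ι]
    (nbrs : ι → Finset ι) (D : ℕ) (hD : ∀ c, (nbrs c).card ≤ D) (S : ι → Finset G.Site)
    (EW : List ι → (X → ℝ) →ₗ[ℝ] F₂) (A q δ' N : ℝ) (Wt : G.Site → ℝ) (hA : 0 ≤ A) (hWt : ∀ y, 0 ≤ Wt y)
    (hq : 0 ≤ q) (hN : 0 ≤ N) (hDq : (D : ℝ) * q ≤ 1 / 2)
    (hW : ∀ (n : ℕ) (c : ι), ∀ ω ∈ walksFrom nbrs n c,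
      HasMaj b₁ b₂ (EW ω) (fun a e => (if a ∈ S c then A * Wt a else 0) * q ^ n * Real.exp (-(δ' * G.dist a e))))
    (hcnt : ∀ a : G.Site, (∑ c, if a ∈ S c then (1 : ℝ) else 0) ≤ N) (m : ℕ) :
    HasMaj b₁ b₂ (∑ n ∈ Finset.range m, ∑ c, ∑ ω ∈ walksFrom nbrs n c, EW ω)
      (fun a e => 2 * N * A * Wt a * Real.exp (-(δ' * G.dist a e))) := by
  -- level n, cube c: at most D^n walks, each with the same majorant
  have hlevel : ∀ n c, HasMaj b₁ b₂ (∑ ω ∈ walksFrom nbrs n c, EW ω)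
      (fun a e => (D : ℝ) ^ n * ((if a ∈ S c then A * Wt a else 0) * q ^ n * Real.exp (-(δ' * G.dist a e)))) := by
    intro n c
    refine (hasMaj_finsetSum (walksFrom nbrs n c) EW
        (fun _ a e => (if a ∈ S c then A * Wt a else 0) * q ^ n * Real.exp (-(δ' * G.dist a e)))
        (hW n c)).mono fun a e => ?_
    have hnn : 0 ≤ (if a ∈ S c then A * Wt a else 0) * q ^ n * Real.exp (-(δ' * G.dist a e)) :=
      mul_nonneg (mul_nonneg (by split_ifs <;> first | exact mul_nonneg hA (hWt a) | exact le_rfl)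
        (pow_nonneg hq n)) (Real.exp_nonneg _)
    rw [Finset.sum_const, nsmul_eq_mul]
    refine mul_le_mul_of_nonneg_right ?_ hnn
    exact_mod_cast card_walksFrom_le nbrs hD n c
  -- sum over the initial cube: the overlap count N
  have hn : ∀ n, HasMaj b₁ b₂ (∑ c, ∑ ω ∈ walksFrom nbrs n c, EW ω)
      (fun a e => N * A * Wt a * Real.exp (-(δ' * G.dist a e)) * ((D : ℝ) * q) ^ n) := by
    intro n
    refine (hasMaj_finsetSum Finset.univ _ _ fun c _ => hlevel n c).mono fun a e => ?_
    have hE : 0 ≤ A * Wt a * Real.exp (-(δ' * G.dist a e)) * ((D : ℝ) * q) ^ n :=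
      mul_nonneg (mul_nonneg (mul_nonneg hA (hWt a)) (Real.exp_nonneg _))
        (pow_nonneg (mul_nonneg (Nat.cast_nonneg D) hq) n)
    calc ∑ c, (D : ℝ) ^ n * ((if a ∈ S c then A * Wt a else 0) * q ^ n * Real.exp (-(δ' * G.dist a e)))
        = (∑ c, if a ∈ S c then (1 : ℝ) else 0) *
            (A * Wt a * Real.exp (-(δ' * G.dist a e)) * ((D : ℝ) * q) ^ n) := by
          rw [Finset.sum_mul]
          refine Finset.sum_congr rfl fun c _ => ?_
          split_ifs <;> ring
      _ ≤ N * (A * Wt a * Real.exp (-(δ' * G.dist a e)) * ((D : ℝ) * q) ^ n) :=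
          mul_le_mul_of_nonneg_right (hcnt a) hE
      _ = _ := by ring
  -- sum over n < m: geometric series with ratio Dq ≤ ½
  refine (hasMaj_finsetSum (Finset.range m) _ _ fun n _ => hn n).mono fun a e => ?_
  have hC : 0 ≤ N * A * Wt a * Real.exp (-(δ' * G.dist a e)) :=
    mul_nonneg (mul_nonneg (mul_nonneg hN hA) (hWt a)) (Real.exp_nonneg _)
  have hgeom := B9.walkSum_le (N * A * Wt a * Real.exp (-(δ' * G.dist a e))) ((D : ℝ) * q)
    (fun _ => 1) (fun n => N * A * Wt a * Real.exp (-(δ' * G.dist a e)) * ((D : ℝ) * q) ^ n) hC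
    (mul_nonneg (Nat.cast_nonneg D) hq) hDq (fun n => le_of_eq (one_mul _)) m
  calc ∑ n ∈ Finset.range m, N * A * Wt a * Real.exp (-(δ' * G.dist a e)) * ((D : ℝ) * q) ^ n
      = ∑ n ∈ Finset.range m, 1 * (N * A * Wt a * Real.exp (-(δ' * G.dist a e)) * ((D : ℝ) * q) ^ n) := by
        simp only [one_mul]
    _ ≤ 2 * (N * A * Wt a * Real.exp (-(δ' * G.dist a e))) := hgeom
    _ = _ := by ring

end Cor38Left

end

end Literature.MathematicalPhysics.QuantumFieldTheory.Balaban1983to89.B9Thm37AllNorms
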